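import Literature.Topology.FourManifolds.TrisectionFunctor
import Literature.Topology.FourManifolds.TrisectionsRefutation
import HarnessLib

/-!
# Proofs for `TrisectionFunctor.lean`: the facts over `IsBalancedTrisection` hold vacuously or fail

Sibling proof file of `Literature/Topology/FourManifolds/TrisectionFunctor.lean` (D-0014: named facts
`def X : Prop` are discharged as `theorem X_holds : X`; fact items
`provefact-Literature.exists_stabilized_trisection`, `provefact-Literature.diffeomorph_of_iso_groupTrisectionOf`,
`provefact-Literature.sphere_trisections`). It records, for the named facts (a)–(e), (g) of that file:

* `Literature.exists_stabilized_trisection_holds : exists_stabilized_trisection` — fact (c) of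
  `TrisectionFunctor.lean`: a balanced `(g, k)`-trisected closed connected oriented smooth
  4-manifold admits a balanced `(g + 3, k + 1)`-trisection whose Abrams–Gay–Kirby kernel triple is
  isomorphic to the algebraic stabilisation `TrisectionKernels.stabilize` of the original one
  (Gay–Kirby 2016, Def. 8 and Lemma 10; Abrams–Gay–Kirby 2018, Def. 3 and Thm. 5);
* `Literature.Topology.FourManifolds.isGroupTrisection_groupTrisectionOf_holds` (a), `Literature.Topology.FourManifolds.diffeomorph_of_iso_groupTrisectionOf_holds`
  (b), `Literature.Topology.FourManifolds.exists_marking_centralSurface_holds` (g) — the same way (vacuously, see below);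
* `Literature.not_sphere_trisections : ¬ sphere_trisections` — fact (d) (Gay–Kirby 2016, §2 and Def. 9,
  Fig. 3: the standard genus-`3 + 3m` trisections of the round `S⁴`) is **false as stated**, being
  an existential over the unsatisfiable predicate;
* `Literature.not_exists_trisected_of_isGroupTrisection : ¬ exists_trisected_of_isGroupTrisection` — fact
  (e) (Abrams–Gay–Kirby 2018, Thm. 5, the map `ℳ`) is **false as stated** for the same reason,
  witnessed by the `(0, 0)` trisection of the trivial group (`Literature.Topology.FourManifolds.trivialKernels_isGroupTrisection`,
  the universe-polymorphic form of `GroupTrisection.trivial`).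

(Verdict clean-up 2026-08-15: the two refuted defs (d), (e) are `@[deprecated]` in
`TrisectionFunctor.lean`, kept verbatim as the subjects of these refutations; the deprecation
linter is silenced at exactly the two refuting theorems below, which must name them.)

**How, and a warning.** Each fact quantifies over, or asks for, a hypothesis
`h : IsBalancedTrisection X g k S`, and the vendored predicate `Literature.Topology.FourManifolds.IsTrisection` is unsatisfiable
(`Literature.Topology.FourManifolds.TrisectionRefutation.not_isTrisection`, `TrisectionsRefutation.lean`: its clause (ii) makes
the three sectors smoothly embedded manifolds *with boundary* meeting at the points of the non-empty
central surface, which is impossible to first order, whereas Gay–Kirby's sectors have *corners*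
along the central surface). Hence the universally quantified statements (a), (b), (c), (g) hold
**vacuously**, and that is the proof given here — nothing of the printed theorems is used — while
the existential statements (d), (e) are refuted. The mathematical content — Gay–Kirby's Lemma 10
(the stabilisation of a `(g, k)`-trisection of `X` is a `(g + 3, k + 1)`-trisection of the same `X`),
the genus-`0` trisection of `S⁴ ⊂ ℂ × ℝ³` into the three sectors `2πj/3 ≤ θ ≤ 2π(j+1)/3` and its
stabilisations (Gay–Kirby 2016, §2: "Stabilizing the genus `0` trisection of `S⁴` gives a genus `3`
trisection, with trisection diagram shown in Figure 3 […] the standard genus `3` trisection of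
`S⁴`"; "Stabilization can then also be defined as performing a connected sum with `S⁴` with its
standard genus `3` trisection"), and Abrams–Gay–Kirby's Thm. 5 ("the standard `(3, 1)`-trisection
of `{1}` maps to the standard `(3, 1)`-trisection of `S⁴`, and connected sums of group trisections
map to connected sums of 4-manifold trisections"; p. 1542: "the connected sum operation and the
`(3, 1)`-trisection on the group side are constructed exactly to correspond to stabilization of
manifolds via the map `ℳ`") — is carried by the corrected named facts stated over the satisfiable
predicate `Literature.Topology.FourManifolds.IsBalancedGKTrisection` in `TrisectionFunctorGK.lean`
(`Literature.Topology.FourManifolds.isGroupTrisection_groupGKTrisectionOf`, `Literature.Topology.FourManifolds.diffeomorph_of_iso_groupGKTrisectionOf`,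
`Literature.Topology.FourManifolds.exists_stabilized_gkTrisection`, `Literature.Topology.FourManifolds.sphere_gkTrisections`,
`Literature.Topology.FourManifolds.exists_gkTrisected_of_isGroupTrisection`, `Literature.Topology.FourManifolds.exists_marking_centralSurface_of_gkTrisection`),
none of which is proved in the tree.

## References

* A. Abrams, D. Gay, R. Kirby, *Group trisections and smooth 4-manifolds*, Geom. Topol. 22 (2018)
  1537–1545 (arXiv:1605.06731): Def. 1 (p. 1538), Def. 3 (p. 1540), the map `𝒢` (p. 1540), Thm. 5
  (p. 1541), end of the proof of Thm. 5 (p. 1542).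
* D. Gay, R. Kirby, *Trisecting 4-manifolds*, Geom. Topol. 20 (2016) 3097–3132 (arXiv:1205.1565):
  Def. 1 (p. 3098), Def. 8 (p. 3099), Def. 9, Fig. 3 and Lemma 10 (p. 3100), §2 (pp. 3100–3101:
  the genus-`0` and the standard genus-`3` trisections of `S⁴`).
-/

noncomputable section

open scoped Manifold ContDiff

namespace Literature.Topology.FourManifolds

universe u

/-- **Fact (c) of `TrisectionFunctor.lean` holds — vacuously.** Stabilisation compatibility
(Gay–Kirby 2016, Def. 8 and Lemma 10; Abrams–Gay–Kirby 2018, Def. 3 and Thm. 5): a balanced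
`(g, k)`-trisected closed connected oriented smooth 4-manifold admits a balanced `(g + 3, k + 1)`-
trisection whose kernel triple is isomorphic to `(groupTrisectionOf h x₀ μ).stabilize`.  The proof
uses only that the hypothesis `IsBalancedTrisection X g k S` is contradictory
(`TrisectionRefutation.not_isTrisection`: the vendored sectors are manifolds with boundary, but
Gay–Kirby's sectors have corners along the central surface), so the printed theorem is not
formalised by this declaration; see `exists_stabilized_gkTrisection` for the faithful restatement
over `IsBalancedGKTrisection`. [cite: AbramsGayKirby2018, Def. 3 (p. 1540) and Thm. 5 (p. 1541)]
[cite: GayKirby2016, Def. 8 (p. 3099) and Lemma 10 (p. 3100)] -/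
theorem exists_stabilized_trisection_holds : exists_stabilized_trisection.{u} := by
  intro X _ _ _ _ _ _ _ _ g k S h
  exact (TrisectionRefutation.not_isTrisection h).elim

/-! ### (a), (b), (g): vacuous discharges -/

/-- **Fact (a) of `TrisectionFunctor.lean` holds — vacuously** (Abrams–Gay–Kirby 2018, p. 1540, the
map `𝒢`, and Thm. 5: the kernel triple of a balanced trisected closed oriented 4-manifold is a
`(g, k)` group trisection of `π₁ X`).  Only the contradiction `TrisectionRefutation.not_isTrisection h`
is used; the faithful restatement is `isGroupTrisection_groupGKTrisectionOf`
(`TrisectionFunctorGK.lean`). [cite: AbramsGayKirby2018, Thm. 5 (p. 1541) and p. 1540 (the map 𝒢)] -/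
theorem isGroupTrisection_groupTrisectionOf_holds : isGroupTrisection_groupTrisectionOf.{u} := by
  intro X _ _ _ _ _ _ _ _ g k S h
  exact (TrisectionRefutation.not_isTrisection h).elim

/-- **Fact (b) of `TrisectionFunctor.lean` holds — vacuously** (Abrams–Gay–Kirby 2018, Thm. 5,
rigidity: balanced trisected closed oriented 4-manifolds with isomorphic kernel triples are
diffeomorphic).  Only the contradiction `TrisectionRefutation.not_isTrisection h` is used; the
faithful restatement is `diffeomorph_of_iso_groupGKTrisectionOf` (`TrisectionFunctorGK.lean`).
[cite: AbramsGayKirby2018, Thm. 5 (p. 1541)] -/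
theorem diffeomorph_of_iso_groupTrisectionOf_holds : diffeomorph_of_iso_groupTrisectionOf.{u} := by
  intro X _ _ _ _ _ _ _ _ X' _ _ _ _ _ _ _ _ g k S S' h
  exact (TrisectionRefutation.not_isTrisection h).elim

/-- **Fact (g) of `TrisectionFunctor.lean` holds — vacuously** (Gay–Kirby 2016, Def. 1: the central
surface `F_g = X₁ ∩ X₂ ∩ X₃` is a closed genus-`g` surface, so a base point and a marking
`S_g ≃* π₁(F, x₀)` exist).  Only the contradiction `TrisectionRefutation.not_isTrisection` is used;
the faithful restatement is `exists_marking_centralSurface_of_gkTrisection`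
(`TrisectionFunctorGK.lean`). [cite: GayKirby2016, Def. 1] -/
theorem exists_marking_centralSurface_holds : exists_marking_centralSurface.{u} := by
  intro X _ _ _ _ _ _ _ _ g k S h
  exact (TrisectionRefutation.not_isTrisection h).elim

/-! ### (d), (e): refutations -/

-- `sphere_trisections` is `@[deprecated]` (refuted here; verdict clean-up 2026-08-15) and its refutation must
-- name it; REMOVE-WHEN the deprecated def is deleted from `TrisectionFunctor.lean`.
set_option linter.deprecated false in
/-- **`Literature.Topology.FourManifolds.sphere_trisections` (fact (d) of `TrisectionFunctor.lean`) is false as stated.**  Already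
for `m = 0` it asserts a balanced `(3, 1)`-trisection of the round `S⁴ ⊆ ℝ⁵` in the sense of
`Literature.Topology.FourManifolds.IsBalancedTrisection`, and no space carries any `Literature.Topology.FourManifolds.IsTrisection`
(`TrisectionRefutation.not_isBalancedTrisection`: smoothly embedded manifolds with boundary cannot
meet three at a time along the non-empty central surface; Gay–Kirby's sectors
`X_j = {(re^{iθ}, x₃, x₄, x₅) | 2πj/3 ≤ θ ≤ 2π(j+1)/3}` of `S⁴ ⊂ ℂ × ℝ³` (§2) have corners along
`F`).  The printed mathematics (Gay–Kirby 2016, §2: the genus-`0` trisection of `S⁴`, its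
stabilisation "the standard genus `3` trisection of `S⁴`" with diagram Fig. 3, and "Stabilization
can then also be defined as performing a connected sum with `S⁴` with its standard genus `3`
trisection", Def. 8–9 and Lemma 10) is vendored faithfully as `Literature.Topology.FourManifolds.sphere_gkTrisections`
(`TrisectionFunctorGK.lean`, over `IsBalancedGKTrisection`).
[cite: GayKirby2016, Def. 9 and Fig. 3 (p. 3100)] -/
theorem not_sphere_trisections : ¬ sphere_trisections := by
  intro h
  obtain ⟨S, hS, -⟩ := h 0
  exact TrisectionRefutation.not_isBalancedTrisection hS

/-- The trivial kernel triple in genus `0` is a `(0, 0)` group trisection of the trivial group, in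
any universe (`GroupTrisection.trivial` is the `Type 0` instance): `S_0 = {1}`, so all seven
quotients are trivial, i.e. free of rank `0`, and the triple pushout is `{1}` (Abrams–Gay–Kirby
2018, Def. 1 and §1: "the unique `(0, 0)`-trisection of `{1}`"). [cite: AbramsGayKirby2018, Def. 1] -/
theorem trivialKernels_isGroupTrisection : IsGroupTrisection 0 0 (PUnit : Type u) trivialKernels where
  normal _ := Subgroup.normal_top
  free_quotient _ := isFreeOfRank_zero_of_subsingleton _
  free_pairQuotient _ _ _ := isFreeOfRank_zero_of_subsingleton _
  triple := ⟨letI : Unique trivialKernels.tripleQuotient := uniqueOfSubsingleton 1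
    MulEquiv.ofUnique⟩

-- `exists_trisected_of_isGroupTrisection` is `@[deprecated]` (refuted here; verdict clean-up 2026-08-15) and its
-- refutation must name it; REMOVE-WHEN the deprecated def is deleted from `TrisectionFunctor.lean`.
set_option linter.deprecated false in
/-- **`Literature.Topology.FourManifolds.exists_trisected_of_isGroupTrisection` (fact (e) of `TrisectionFunctor.lean`) is false as
stated.**  Applied to the `(0, 0)` trisection of the trivial group (`trivialKernels_isGroupTrisection`)
it would produce a closed oriented 4-manifold with an `Literature.Topology.FourManifolds.IsBalancedTrisection`, and there is none
(`TrisectionRefutation.not_isBalancedTrisection`).  Abrams–Gay–Kirby's Thm. 5 (the map `ℳ`, with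
`𝒢 ∘ ℳ = id` up to trisected isomorphism; "the unique `(0, 0)`-trisection of `{1}` maps to the
unique `(0, 0)`-trisection of `S⁴`") is vendored faithfully as
`Literature.Topology.FourManifolds.exists_gkTrisected_of_isGroupTrisection` (`TrisectionFunctorGK.lean`).
[cite: AbramsGayKirby2018, Thm. 5 (p. 1541)] -/
theorem not_exists_trisected_of_isGroupTrisection : ¬ exists_trisected_of_isGroupTrisection.{u} := by
  intro h
  obtain ⟨X, _, _, _, _, _, _, _, _, S, hS, -⟩ :=
    h 0 0 (PUnit : Type u) trivialKernels trivialKernels_isGroupTrisection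
  exact TrisectionRefutation.not_isBalancedTrisection hS

end Literature.Topology.FourManifolds

end
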